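import Mathlib
import HarnessLib
import Summits.Ventures.LatticeQCDFlow.Exactness.NCMCGeneralSpaceESSCLT
import Summits.Ventures.LatticeQCDFlow.Exactness.NCMCGeneralSpaceStudentizedCLT

/-!
# The delta method along an estimator sequence, and the asymptotic law of the variance-inflation factor `1/essHat`

HONEST FRAMING: exact (Metropolis-corrected) sampling algorithms for lattice gauge theory;
figures of merit are autocorrelation/cost numbers at stated couplings and volumes; no
continuum-physics claim.

Venture `LatticeQCDFlow` (cell pub-lqcd), topic `Exactness`; FANOUT row 13 (`eng-snf`, GEN-14).
NEW WORK of the cell (elementary asymptotic statistics: Slutsky's theorem from Mathlib and the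
exact identity `φ(R) − φ(θ) = (R − θ) · dslope φ θ R`), not a published result; nothing is cited as
a fact (the "delta method" named only).  `NCMCGeneralSpaceTwoSampleCLT.lean` (GEN-12) proved the
delta method for `log` along an estimator sequence; THIS file states it for an ARBITRARY measurable
`φ` differentiable at the limit (one lemma to serve every smooth functional of the engine's reported
numbers), and applies it to `x ↦ x⁻¹` on GEN-13's CLT for the Kish fraction
(`NCMCGeneralSpaceESSCLT.lean`): the reported VARIANCE-INFLATION FACTOR `1/essHat_n` — the number
the error bar of `dF` is built from — is asymptotically normal around `1/ESS_F = E_F e^{−2W_d}`.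

## Setting and content

* `measurable_dslope` — `dslope φ θ` is measurable for measurable `φ`;
  **`tendstoInDistribution_sqrt_mul_delta`** — THE DELTA METHOD: for measurable estimators
  `R_n → θ` a.s. with `√n (R_n − θ) →d Y₀` and a measurable `φ` differentiable at `θ`,
  `√n (φ(R_n) − φ(θ)) →d φ'(θ) · Y₀`.
* `μ` a probability law, `w > 0` measurable with `w² ∈ L²(μ)`, `θ = E w`, `m₂ = E w²`:
  **`tendstoInDistribution_sqrt_mul_inv_essHat_sub`** —
  `√n (1/essHat_n − m₂/θ²) →d N(0, Var_μ[2 m₂ w − θ w²]/θ⁶)` (GEN-13's essHat CLT + the delta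
  method at `x ↦ x⁻¹`).
* For a Crooks pair `(κF, κR, s, e, W)` from `ν₀` to `ν₁` with `e^{−2W} ∈ L²(P_F)` and
  `e^{−ΔF} = Z₁/Z₀`, `W_d = W − ΔF`, `D = E_F e^{−2W_d} = 1/ESS_F`:
  **`CrooksPair.tendstoInDistribution_inv_essHat_dissipation`** —
  `√n (1/essHat(e^{−W_i})_{i<n} − D) →d N(0, Var_F[2D e^{−W_d} − e^{−2W_d}])`.
  Reading for the engine (`estimators.ess`, the `err` of `dF`, which is `√((1/essHat − 1)/n)`): the
  variance-inflation factor read off `N` independent evolutions fluctuates at scale `N^{−1/2}` with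
  variance `Var_F[2D e^{−W_d} − e^{−2W_d}]`, finite iff `E_F e^{−4W} < ∞` — the reported error bar
  is itself only as steady as the FOURTH exponential moment of the work allows.

Scope / NOT CLAIMED: independent evolutions only; no rate, no finite-`N` statement; the variance of
`1/essHat` is not estimated here (no plug-in); no value for any concrete protocol.
-/

namespace Summit.Ventures.LatticeQCDFlow.Exactness.GeneralNCMC

open MeasureTheory ProbabilityTheory Set Filter Finset
open scoped ENNReal NNReal Topology

variable {E : Type*} [MeasurableSpace E]

/-! ## The delta method along an estimator sequence -/

/-- `dslope φ θ` (the difference quotient of `φ` at `θ`, extended by `deriv φ θ`) is measurable for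
a measurable `φ`. -/
theorem measurable_dslope {φ : ℝ → ℝ} (hφm : Measurable φ) (θ : ℝ) : Measurable (dslope φ θ) := by
  have h : dslope φ θ = fun b => if b = θ then deriv φ θ else (φ b - φ θ) / (b - θ) := by
    funext b
    by_cases hb : b = θ
    · rw [hb, if_pos rfl, dslope_same]
    · rw [if_neg hb, dslope_of_ne _ hb, slope_def_field]
  rw [h]
  refine Measurable.ite ?_ measurable_const ?_
  · exact (measurableSet_singleton θ : MeasurableSet {b : ℝ | b = θ})
  · exact (hφm.sub measurable_const).div (measurable_id.sub measurable_const)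

section Delta

variable {Ω'' : Type*} [MeasurableSpace Ω''] {P : Measure Ω''} [IsProbabilityMeasure P]
variable {Ω' : Type*} [MeasurableSpace Ω'] {P' : Measure Ω'} [IsProbabilityMeasure P']

/-- **The delta method.**  If measurable estimators `R_n → θ` almost surely, `√n (R_n − θ) →d Y₀`,
and `φ` is measurable and differentiable at `θ`, then `√n (φ(R_n) − φ(θ)) →d φ'(θ) · Y₀`
(`φ(R) − φ(θ) = (R − θ) · dslope φ θ R` exactly; `dslope φ θ (R_n) → φ'(θ)` a.s. by continuity of
`dslope φ θ` at `θ`; Slutsky). -/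
theorem tendstoInDistribution_sqrt_mul_delta {R : ℕ → Ω'' → ℝ} {θ : ℝ} {φ : ℝ → ℝ}
    (hφm : Measurable φ) (hφ : DifferentiableAt ℝ φ θ) (hRm : ∀ n, Measurable (R n))
    (hae : ∀ᵐ ω ∂P, Tendsto (fun n => R n ω) atTop (𝓝 θ)) {Y₀ : Ω' → ℝ}
    (hclt : TendstoInDistribution (fun (n : ℕ) ω => √(n : ℝ) * (R n ω - θ)) atTop Y₀ (fun _ => P) P') :
    TendstoInDistribution (fun (n : ℕ) ω => √(n : ℝ) * (φ (R n ω) - φ θ)) atTop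
      (fun ω' => deriv φ θ * Y₀ ω') (fun _ => P) P' := by
  have hBmeas : ∀ n, AEMeasurable (fun ω => dslope φ θ (R n ω)) P :=
    fun n => ((measurable_dslope hφm θ).comp (hRm n)).aemeasurable
  have hB : TendstoInMeasure P (fun n ω => dslope φ θ (R n ω)) atTop (fun _ => deriv φ θ) := by
    refine tendstoInMeasure_of_tendsto_ae (fun n => (hBmeas n).aestronglyMeasurable) ?_
    filter_upwards [hae] with ω hω
    have hcont : ContinuousAt (dslope φ θ) θ := continuousAt_dslope_same.2 hφ
    have hval : dslope φ θ θ = deriv φ θ := dslope_same φ θ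
    rw [← hval]
    exact hcont.tendsto.comp hω
  have slutsky := hclt.continuous_comp_prodMk_of_tendstoInMeasure_const
    (g := fun p : ℝ × ℝ => p.2 * p.1) (by fun_prop) hB hBmeas
  simp only at slutsky
  convert slutsky using 3 with n ω
  have key := sub_smul_dslope φ θ (R n ω)
  rw [smul_eq_mul] at key
  linear_combination (-√(n : ℝ)) * key

end Delta

/-! ## The asymptotic law of `1/essHat` along an i.i.d. run -/

section IID

variable (μ : Measure E) [IsProbabilityMeasure μ]
variable {Ω' : Type*} [MeasurableSpace Ω'] {P' : Measure Ω'} [IsProbabilityMeasure P']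

/-- **CLT for the variance-inflation factor `1/essHat`.**  For a positive measurable weight with
`w² ∈ L²(μ)`, `θ = E_μ w`, `m₂ = E_μ w²`, along an infinite i.i.d. run
`√n (1/essHat_n − m₂/θ²) →d N(0, Var_μ[2 m₂ w − θ w²]/θ⁶)`. -/
theorem tendstoInDistribution_sqrt_mul_inv_essHat_sub {w : E → ℝ} (hwm : Measurable w)
    (hwpos : ∀ a, 0 < w a) (hL2sq : MemLp (fun a => w a ^ 2) 2 μ) {Y : Ω' → ℝ}
    (hY : HasLaw Y (gaussianReal 0
      (Var[fun a => 2 * (∫ a, w a ^ 2 ∂μ) * w a - (∫ a, w a ∂μ) * w a ^ 2; μ] /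
        (∫ a, w a ∂μ) ^ 6).toNNReal) P') :
    TendstoInDistribution
      (fun (n : ℕ) (ω : ℕ → E) => √(n : ℝ) *
        (1 / essHat (fun i : Fin n => w (ω i)) - (∫ a, w a ^ 2 ∂μ) / (∫ a, w a ∂μ) ^ 2))
      atTop Y (fun _ => Measure.infinitePi fun _ : ℕ => μ) P' := by
  set θ := ∫ a, w a ∂μ with hθdef
  set σ := ∫ a, w a ^ 2 ∂μ with hσdef
  set P := Measure.infinitePi fun _ : ℕ => μ with hP
  have hL2 : MemLp w 2 μ :=
    (memLp_two_iff_integrable_sq hwm.aestronglyMeasurable).2 (hL2sq.integrable one_le_two)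
  have hwi : Integrable w μ := hL2.integrable one_le_two
  have hθ : 0 < θ := by
    rw [hθdef, integral_pos_iff_support_of_nonneg (fun a => (hwpos a).le) hwi]
    have hsupp : Function.support w = univ := by
      ext a
      simp only [Function.mem_support, mem_univ, iff_true]
      exact (hwpos a).ne'
    rw [hsupp, measure_univ]
    exact one_pos
  have hσ : 0 < σ := by
    rw [hσdef, integral_pos_iff_support_of_nonneg (fun a => sq_nonneg (w a)) hL2.integrable_sq]
    have hsupp : Function.support (fun a => w a ^ 2) = univ := by
      ext a
      simp only [Function.mem_support, mem_univ, iff_true]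
      exact (pow_pos (hwpos a) 2).ne'
    rw [hsupp, measure_univ]
    exact one_pos
  set ess := θ ^ 2 / σ with hess
  have hessne : ess ≠ 0 := div_ne_zero (pow_ne_zero 2 hθ.ne') hσ.ne'
  -- the variance bookkeeping: `V₂₃ = θ² Var[2σw − θw²]/σ⁴` and `c = −ess²`
  set V' := Var[fun a => 2 * σ * w a - θ * w a ^ 2; μ] with hV'
  set u := V' / θ ^ 6 with hu
  have hu0 : 0 ≤ u := div_nonneg (variance_nonneg _ μ) (pow_nonneg hθ.le 6)
  have hVar : Var[fun a => 2 * θ * σ * w a - θ ^ 2 * w a ^ 2; μ] = θ ^ 2 * V' := by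
    rw [hV', ← variance_const_mul]
    congr 1
    funext a
    ring
  set c := -(ess ^ 2) with hc
  have hY₀ : HasLaw (fun ω' => c * Y ω')
      (gaussianReal 0 (Var[fun a => 2 * θ * σ * w a - θ ^ 2 * w a ^ 2; μ] / σ ^ 4).toNNReal) P' := by
    have h := gaussianReal_const_mul hY c
    rw [mul_zero] at h
    convert h using 3
    apply NNReal.eq
    rw [NNReal.coe_mul, NNReal.coe_mk, Real.coe_toNNReal _ hu0,
      Real.coe_toNNReal _ (div_nonneg (variance_nonneg _ μ) (pow_nonneg hσ.le 4)), hVar, hc, hess, hu]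
    field_simp
  have clt := tendstoInDistribution_sqrt_mul_essHat_sub μ hwm hwpos hL2sq hY₀
  -- the delta method at `x ↦ x⁻¹`
  have hRm : ∀ n, Measurable fun ω : ℕ → E => essHat (fun i : Fin n => w (ω i)) :=
    fun n => measurable_essHat_run hwm n
  have hae := tendsto_essHat_ae μ hwm hL2 hσ.ne'
  have hdelta := tendstoInDistribution_sqrt_mul_delta (φ := fun x : ℝ => x⁻¹) measurable_inv
    (hasDerivAt_inv hessne).differentiableAt hRm hae clt
  refine hdelta.congr (fun n => Eventually.of_forall fun ω => ?_) (Eventually.of_forall fun ω' => ?_)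
  · beta_reduce
    simp only [one_div, hess, inv_div]
  · show deriv (fun x : ℝ => x⁻¹) ess * (c * Y ω') = Y ω'
    rw [(hasDerivAt_inv hessne).deriv, hc]
    field_simp

end IID

/-! ## For a Crooks pair: the variance-inflation factor is asymptotically normal around `E_F e^{−2W_d}` -/

namespace CrooksPair

variable {Ω : Type*} [MeasurableSpace Ω]
variable {ν₀ ν₁ : Measure Ω} {κF κR : Kernel Ω E} {s e : E → Ω} {W : E → ℝ}
variable {Ω' : Type*} [MeasurableSpace Ω'] {P' : Measure Ω'} [IsProbabilityMeasure P']

/-- **CLT for `1/essHat` of a Crooks pair.**  For every Crooks pair on a general measurable state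
space with `e^{−2W} ∈ L²(P_F)` and `e^{−ΔF} = Z₁/Z₀`, along an infinite run of independent forward
evolutions, with `W_d = W − ΔF` and `D = E_F e^{−2W_d} = 1/ESS_F`:
`√n (1/essHat(e^{−W_i})_{i<n} − D) →d N(0, Var_F[2D e^{−W_d} − e^{−2W_d}])`. -/
theorem tendstoInDistribution_inv_essHat_dissipation [IsFiniteMeasure ν₀] [IsFiniteMeasure ν₁]
    [IsMarkovKernel κF] [IsMarkovKernel κR] (h0 : ν₀ univ ≠ 0) (h1 : ν₁ univ ≠ 0)
    (h : CrooksPair ν₀ ν₁ κF κR s e W)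
    (hL2sq : MemLp (fun ε => Real.exp (-(2 * W ε))) 2 (fwdPathLaw ν₀ κF)) {ΔF : ℝ}
    (hΔF : Real.exp (-ΔF) = ((ν₀ univ)⁻¹ * ν₁ univ).toReal) {Y : Ω' → ℝ}
    (hY : HasLaw Y (gaussianReal 0
      (Var[fun ε => 2 * (∫ ε, Real.exp (-(2 * (W ε - ΔF))) ∂(fwdPathLaw ν₀ κF)) *
          Real.exp (-(W ε - ΔF)) - Real.exp (-(2 * (W ε - ΔF))); fwdPathLaw ν₀ κF]).toNNReal) P') :
    haveI := isProbabilityMeasure_fwdPathLaw ν₀ h0 κF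
    TendstoInDistribution
      (fun (n : ℕ) (ω : ℕ → E) => √(n : ℝ) *
        (1 / essHat (fun i : Fin n => Real.exp (-W (ω i))) -
          ∫ ε, Real.exp (-(2 * (W ε - ΔF))) ∂(fwdPathLaw ν₀ κF)))
      atTop Y (fun _ => Measure.infinitePi fun _ : ℕ => fwdPathLaw ν₀ κF) P' := by
  haveI := isProbabilityMeasure_fwdPathLaw ν₀ h0 κF
  set D := ∫ ε, Real.exp (-(2 * (W ε - ΔF))) ∂(fwdPathLaw ν₀ κF) with hDdef
  have hwm : Measurable fun ε => Real.exp (-W ε) := Real.measurable_exp.comp h.measurable_W.neg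
  have hsq : ∀ ε, Real.exp (-W ε) ^ 2 = Real.exp (-(2 * W ε)) := fun ε => by
    rw [sq, ← Real.exp_add]
    congr 1
    ring
  have hL2 : MemLp (fun ε => Real.exp (-W ε)) 2 (fwdPathLaw ν₀ κF) := by
    refine (memLp_two_iff_integrable_sq hwm.aestronglyMeasurable).2 ?_
    simp_rw [hsq]
    exact hL2sq.integrable one_le_two
  -- `ESS_F = 1/D > 0`
  have hess := h.essPop_eq_inv_dissipation h0 h1 hΔF
  have hθpos : 0 < ∫ ε, Real.exp (-W ε) ∂(fwdPathLaw ν₀ κF) := by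
    rw [h.integral_exp_neg_work, hΔF.symm]
    exact Real.exp_pos _
  have hm2 : 0 < ∫ ε, Real.exp (-(2 * W ε)) ∂(fwdPathLaw ν₀ κF) := by
    have heq : ∫ ε, Real.exp (-W ε) ^ 2 ∂(fwdPathLaw ν₀ κF) =
        ∫ ε, Real.exp (-(2 * W ε)) ∂(fwdPathLaw ν₀ κF) :=
      integral_congr_ae (Eventually.of_forall fun ε => hsq ε)
    rw [← heq, integral_pos_iff_support_of_nonneg (fun ε => sq_nonneg _) hL2.integrable_sq]
    have hsupp : Function.support (fun ε => Real.exp (-W ε) ^ 2) = univ := by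
      ext ε
      simp only [Function.mem_support, mem_univ, iff_true]
      exact (pow_pos (Real.exp_pos _) 2).ne'
    rw [hsupp, measure_univ]
    exact one_pos
  have hEpos : 0 < 1 / D := by
    rw [← hess]
    exact div_pos (pow_pos hθpos 2) hm2
  have hDpos : 0 < D := by
    have := one_div_pos.1 hEpos
    exact this
  have hEne : (1 / D) ≠ 0 := hEpos.ne'
  -- GEN-13's CLT for `essHat` around `1/D`, against `Y₀ = −(1/D²)·Y`
  set c := -(1 / D) ^ 2 with hc
  have hu0 : 0 ≤ Var[fun ε => 2 * D * Real.exp (-(W ε - ΔF)) - Real.exp (-(2 * (W ε - ΔF)));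
      fwdPathLaw ν₀ κF] := variance_nonneg _ _
  have hVar : Var[fun ε => 2 * Real.exp (-(W ε - ΔF)) - (1 / D) * Real.exp (-(2 * (W ε - ΔF)));
      fwdPathLaw ν₀ κF] = (1 / D) ^ 2 *
      Var[fun ε => 2 * D * Real.exp (-(W ε - ΔF)) - Real.exp (-(2 * (W ε - ΔF))); fwdPathLaw ν₀ κF] := by
    rw [← variance_const_mul]
    congr 1
    funext ε
    field_simp
  have hY₀ : HasLaw (fun ω' => c * Y ω') (gaussianReal 0 ((1 / D) ^ 2 *
      Var[fun ε => 2 * Real.exp (-(W ε - ΔF)) - (1 / D) * Real.exp (-(2 * (W ε - ΔF)));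
        fwdPathLaw ν₀ κF]).toNNReal) P' := by
    have hg := gaussianReal_const_mul hY c
    rw [mul_zero] at hg
    convert hg using 3
    apply NNReal.eq
    rw [NNReal.coe_mul, NNReal.coe_mk, Real.coe_toNNReal _ hu0,
      Real.coe_toNNReal _ (mul_nonneg (sq_nonneg _) (variance_nonneg _ _)), hVar, hc]
    ring
  have clt := h.tendstoInDistribution_essHat_dissipation h0 h1 hL2sq hΔF hY₀
  -- the delta method at `x ↦ x⁻¹`
  have hRm : ∀ n, Measurable fun ω : ℕ → E => essHat (fun i : Fin n => Real.exp (-W (ω i))) :=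
    fun n => measurable_essHat_run hwm n
  have hae : ∀ᵐ ω ∂(Measure.infinitePi fun _ : ℕ => fwdPathLaw ν₀ κF), Tendsto
      (fun n : ℕ => essHat (fun i : Fin n => Real.exp (-W (ω i)))) atTop (𝓝 (1 / D)) := by
    have key := h.tendsto_essHat_ae h0 hL2
    rw [hess] at key
    exact key
  have hdelta := tendstoInDistribution_sqrt_mul_delta (φ := fun x : ℝ => x⁻¹) measurable_inv
    (hasDerivAt_inv hEne).differentiableAt hRm hae clt
  refine hdelta.congr (fun n => Eventually.of_forall fun ω => ?_) (Eventually.of_forall fun ω' => ?_)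
  · beta_reduce
    simp only [one_div, inv_inv]
  · show deriv (fun x : ℝ => x⁻¹) (1 / D) * (c * Y ω') = Y ω'
    rw [(hasDerivAt_inv hEne).deriv, hc]
    have hDne : D ≠ 0 := hDpos.ne'
    field_simp

end CrooksPair

end Summit.Ventures.LatticeQCDFlow.Exactness.GeneralNCMC
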